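import Literature.Topology.FourManifolds.TrackLeftInverse
import Literature.Analysis.Calculus.SeeleyExtension
import HarnessLib

/-!
# Chart-level left inverses of the track of an isotopy from an extension of its chart
# expression; Seeley extension in time-dependent half-space charts

Infrastructure for the isotopy extension theorem with **sources with boundary** (Hirsch,
*Differential Topology* (1976), Ch. 8 §1, Thm. 1.3 with `∂V ≠ ∅`; fact seat
`provefact-Literature.isSmoothlyIsotopic_iff_isAmbientIsotopic`).  `TrackLeftInverse.lean`
constructs a smooth local left inverse of the track `(t, x) ↦ (t, F_t x)` about a track point
over an *interior* point `x₀` of `M`, by the inverse function theorem applied to the thickened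
chart expression `K (s, u, w) = (s, ψ (F_s (φ⁻¹ u)) + e (0, w))` of the track in immersion
charts `φ`, `ψ` of the stage `F_{t₀}`.  Over a *boundary* point the chart expression
`k (s, u) = ψ (F_s (φ⁻¹ u))` is `C^∞` only within `ℝ × range I`, and the same construction
goes through as soon as `k` is extended to a `C^∞` map `k̃` on an open neighbourhood of
`(t₀, φ x₀)`:

* `Literature.Topology.FourManifolds.SmoothIsotopy.exists_chartLeftInverse_of_extension` — given
  such an extension `k̃`, there are an open `U ∋ (t₀, F_{t₀} x₀)` in `ℝ × N`, a map
  `Λ : ℝ × N → ℝ × EM`, `C^∞` on `U` with values in the domain of `k̃`, and an open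
  `W ∋ (t₀, x₀)` whose track lies in `U`, with `Λ (t, F_t x) = (t, φ x)` on `W` (a left inverse
  of the track *with values in the chart*, which is what is needed over boundary points, where
  `φ⁻¹` is not smooth off `range I`);
* `Literature.Topology.FourManifolds.exists_contDiffOn_extension_timeHalfSpace` — **Seeley's
  theorem in time-dependent half-space charts**: a map `ℝ × ℝⁿ⁺¹ → V` which is `C^∞` on
  `O ∩ {0 ≤ u 0}` (`O` open) agrees near any point of `O` on the hyperplane `{u 0 = 0}` with a
  `C^∞` map on an open set (the library's
  `Literature.Analysis.Calculus.Seeley.exists_contDiffOn_extension` after the linear change of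
  variables `(s, u) ↦ (u 0, (s, u 1, …, u n))`).

Everything here is proved; no named facts are introduced.

## References

* M. W. Hirsch, *Differential Topology*, GTM 33, Springer (1976), Ch. 8 §1, Thm. 1.3 and its
  proof, p. 180. [HirschDT1976]
* R. T. Seeley, *Extension of `C^∞` functions defined in a half space*, Proc. Amer. Math.
  Soc. 15 (1964), 625–626. [Seeley1964]
-/

open scoped Manifold ContDiff Topology
open Set Function Filter

noncomputable section

namespace Literature.Topology.FourManifolds

/-! ### Seeley extension in time-dependent half-space charts -/

section Seeley

/-- The linear change of variables `(s, u) ↦ (u 0, (s, (u 1, …, u n)))` on `ℝ × ℝⁿ⁺¹`,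
bringing the boundary-defining coordinate `u 0` of the half-space model `𝓡∂ (n + 1)` to the
front (built from `Literature.Topology.FourManifolds.sphereInclusionComplementEquiv`,
`ClosedBall.lean`). [folklore] -/
def timeHalfSpaceSplit (n : ℕ) :
    (ℝ × EuclideanSpace ℝ (Fin (n + 1))) ≃L[ℝ] ℝ × (ℝ × EuclideanSpace ℝ (Fin n)) :=
  let L : EuclideanSpace ℝ (Fin (n + 1)) ≃L[ℝ] ℝ × EuclideanSpace ℝ (Fin n) :=
    ((sphereInclusionComplementEquiv n).symm.trans
      (LinearEquiv.prodComm ℝ (EuclideanSpace ℝ (Fin n)) ℝ)).toContinuousLinearEquiv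
  (((ContinuousLinearEquiv.refl ℝ ℝ).prodCongr L).trans
    (ContinuousLinearEquiv.prodAssoc ℝ ℝ ℝ (EuclideanSpace ℝ (Fin n))).symm).trans
    (((ContinuousLinearEquiv.prodComm ℝ ℝ ℝ).prodCongr
      (ContinuousLinearEquiv.refl ℝ (EuclideanSpace ℝ (Fin n)))).trans
      (ContinuousLinearEquiv.prodAssoc ℝ ℝ ℝ (EuclideanSpace ℝ (Fin n))))

/-- The first component of `timeHalfSpaceSplit` is the boundary coordinate `u 0`
(definitional). [folklore] -/
@[simp]
theorem timeHalfSpaceSplit_apply_fst (n : ℕ) (p : ℝ × EuclideanSpace ℝ (Fin (n + 1))) :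
    (timeHalfSpaceSplit n p).1 = p.2 0 := rfl

/-- **Seeley's theorem in time-dependent half-space charts.**  Let `h : ℝ × ℝⁿ⁺¹ → V` (values in
a complete normed space) be `C^∞` on `O ∩ {p | 0 ≤ p.2 0}` for an open set `O`, and let
`p₀ ∈ O` lie on the hyperplane `{p | p.2 0 = 0}`.  Then there are an open `Õ`, `p₀ ∈ Õ ⊆ O`, and
`h̃ : ℝ × ℝⁿ⁺¹ → V`, `C^∞` on `Õ`, with `h̃ = h` on `Õ ∩ {p | 0 ≤ p.2 0}` — the library's local
form of Seeley's extension theorem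
(`Literature.Analysis.Calculus.Seeley.exists_contDiffOn_extension`, Seeley (1964), Theorem)
transported along `timeHalfSpaceSplit`. [cite: Seeley1964, Theorem] -/
theorem exists_contDiffOn_extension_timeHalfSpace {V : Type*} [NormedAddCommGroup V]
    [NormedSpace ℝ V] [CompleteSpace V] {n : ℕ} {h : ℝ × EuclideanSpace ℝ (Fin (n + 1)) → V}
    {O : Set (ℝ × EuclideanSpace ℝ (Fin (n + 1)))}
    (hO : IsOpen O) {p₀ : ℝ × EuclideanSpace ℝ (Fin (n + 1))} (hp₀ : p₀ ∈ O) (hp₀0 : p₀.2 0 = 0)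
    (hh : ContDiffOn ℝ ∞ h (O ∩ {p | 0 ≤ p.2 0})) :
    ∃ Õ : Set (ℝ × EuclideanSpace ℝ (Fin (n + 1))), IsOpen Õ ∧ p₀ ∈ Õ ∧ Õ ⊆ O ∧
      ∃ h' : ℝ × EuclideanSpace ℝ (Fin (n + 1)) → V,
      ContDiffOn ℝ ∞ h' Õ ∧ EqOn h' h (Õ ∩ {p | 0 ≤ p.2 0}) := by
  set Ξ := timeHalfSpaceSplit n with hΞ
  have hΞ1 : ∀ p, (Ξ p).1 = p.2 0 := fun p => rfl
  -- `h` in the new variables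
  set U : Set (ℝ × (ℝ × EuclideanSpace ℝ (Fin n))) := Ξ.symm ⁻¹' O with hU
  have hUo : IsOpen U := hO.preimage Ξ.symm.continuous
  have hsymm1 : ∀ q : ℝ × (ℝ × EuclideanSpace ℝ (Fin n)), (Ξ.symm q).2 0 = q.1 := fun q => by
    rw [← hΞ1 (Ξ.symm q), Ξ.apply_symm_apply]
  have hf : ContDiffOn ℝ ∞ (h ∘ Ξ.symm) (U ∩ {q | 0 ≤ q.1}) := by
    refine hh.comp Ξ.symm.contDiff.contDiffOn fun q hq => ⟨hq.1, ?_⟩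
    show 0 ≤ (Ξ.symm q).2 0
    rw [hsymm1]
    exact hq.2
  have hq₀ : Ξ p₀ = ((0 : ℝ), (Ξ p₀).2) := Prod.ext (by rw [hΞ1, hp₀0]) rfl
  have h0U : ((0 : ℝ), (Ξ p₀).2) ∈ U := by
    rw [hU, mem_preimage, ← hq₀, Ξ.symm_apply_apply]
    exact hp₀
  obtain ⟨V', hV'o, hV'0, hV'U, g', hg', hg'f⟩ :=
    Literature.Analysis.Calculus.Seeley.exists_contDiffOn_extension hUo h0U hf
  refine ⟨Ξ ⁻¹' V', hV'o.preimage Ξ.continuous, ?_, fun p hp => ?_, g' ∘ Ξ,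
    hg'.comp Ξ.contDiff.contDiffOn fun p hp => hp, fun p hp => ?_⟩
  · rw [mem_preimage, hq₀]
    exact hV'0
  · have := hV'U hp
    rwa [hU, mem_preimage, Ξ.symm_apply_apply] at this
  · show g' (Ξ p) = h p
    rw [hg'f ⟨hp.1, show 0 ≤ (Ξ p).1 by rw [hΞ1]; exact hp.2⟩, comp_apply, Ξ.symm_apply_apply]

end Seeley

namespace SmoothIsotopy

variable {EM HM EN HN : Type*} [NormedAddCommGroup EM] [NormedSpace ℝ EM] [TopologicalSpace HM]
  [NormedAddCommGroup EN] [NormedSpace ℝ EN] [TopologicalSpace HN]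
  {I : ModelWithCorners ℝ EM HM} {J : ModelWithCorners ℝ EN HN}
  {M : Type*} [TopologicalSpace M] [ChartedSpace HM M]
  {N : Type*} [TopologicalSpace N] [ChartedSpace HN N]
  {f g : M → N} (F : SmoothIsotopy I J f g)
  (φ : OpenPartialHomeomorph M HM) (ψ : OpenPartialHomeomorph N HN)
  {F' : Type*} [NormedAddCommGroup F'] [NormedSpace ℝ F'] (e : (EM × F') ≃L[ℝ] EN)

/-! ### The chart expression of the track on the whole chart target -/

/-- The domain on which the chart expression `trackChart F φ ψ` of the track is `C^∞` in the
*within* sense: chart coordinates in the (not necessarily open) target of `φ.extend I`, mapped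
by the stage into the domain of `ψ` (cf. `trackChartDom`, its part over the interior).
[folklore] -/
def trackChartDom' : Set (ℝ × EM) :=
  {p | p.2 ∈ (φ.extend I).target ∧ F.toFun p.1 ((φ.extend I).symm p.2) ∈ ψ.source}

omit [NormedAddCommGroup F'] [NormedSpace ℝ F'] in
/-- Membership in `trackChartDom'`. [folklore] -/
theorem mem_trackChartDom' {p : ℝ × EM} :
    p ∈ F.trackChartDom' φ ψ ↔
      p.2 ∈ (φ.extend I).target ∧ F.toFun p.1 ((φ.extend I).symm p.2) ∈ ψ.source :=
  Iff.rfl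

omit [NormedAddCommGroup F'] [NormedSpace ℝ F'] in
/-- The chart expression of the track is `C^∞` *within* `trackChartDom'` (for charts of the
maximal atlases): up to the boundary of the model. [folklore] -/
theorem contDiffOn_trackChart' (hφ : φ ∈ IsManifold.maximalAtlas I ∞ M)
    (hψ : ψ ∈ IsManifold.maximalAtlas J ∞ N) :
    ContDiffOn ℝ ∞ (F.trackChart φ ψ) (F.trackChartDom' φ ψ) := by
  have h1 : ContMDiffOn 𝓘(ℝ, ℝ × EM) (𝓘(ℝ, ℝ).prod I) ∞
      (fun p : ℝ × EM => ((p.1, (φ.extend I).symm p.2) : ℝ × M)) (F.trackChartDom' φ ψ) := by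
    refine (contDiff_fst.contMDiff.contMDiffOn).prodMk ?_
    refine (contMDiffOn_extend_symm hφ).comp contDiff_snd.contMDiff.contMDiffOn fun p hp => ?_
    rw [← φ.extend_target']
    exact hp.1
  have h2 : ContMDiffOn 𝓘(ℝ, ℝ × EM) J ∞
      (fun p : ℝ × EM => F.toFun p.1 ((φ.extend I).symm p.2)) (F.trackChartDom' φ ψ) :=
    F.contMDiff.comp_contMDiffOn h1
  have h3 : ContMDiffOn 𝓘(ℝ, ℝ × EM) 𝓘(ℝ, EN) ∞ (F.trackChart φ ψ) (F.trackChartDom' φ ψ) :=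
    (ψ.contMDiffOn_extend hψ).comp h2 fun p hp => hp.2
  exact contMDiffOn_iff_contDiffOn.1 h3

/-! ### The thickened extended chart expression -/

/-- The thickening `(s, (u, w)) ↦ (s, k̃ (s, u) + e (0, w))` of a map `k̃ : ℝ × EM → EN` in the
normal directions `e (0 × F')` (cf. `thickTrackChart`, the case `k̃ = trackChart`). [folklore] -/
def thickChart (k : ℝ × EM → EN) (p : ℝ × (EM × F')) : ℝ × EN :=
  (p.1, k (p.1, p.2.1) + e ((0 : EM), p.2.2))

omit [TopologicalSpace HM] [TopologicalSpace HN] in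
/-- Unfolding `thickChart`. [folklore] -/
@[simp]
theorem thickChart_apply (k : ℝ × EM → EN) (p : ℝ × (EM × F')) :
    thickChart e k p = (p.1, k (p.1, p.2.1) + e ((0 : EM), p.2.2)) := rfl

/-- The thickened track in charts of `TrackLeftInverse.lean` is the thickening of the chart
expression of the track: `thickTrackChart F φ ψ e = thickChart e (trackChart F φ ψ)`
(definitional; the lemmas `contDiffOn_thickChart`, `hasFDerivAt_thickChart` below generalize
`contDiffOn_thickTrackChart`, `hasFDerivAt_thickTrackChart` there to an arbitrary `k̃`).
[folklore] -/
theorem thickTrackChart_eq_thickChart :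
    F.thickTrackChart φ ψ e = thickChart e (F.trackChart φ ψ) := rfl

omit [TopologicalSpace HM] [TopologicalSpace HN] in
/-- The thickening of a map `C^∞` on an open set `Õ` is `C^∞` on `{p | (p.1, p.2.1) ∈ Õ}`.
[folklore] -/
theorem contDiffOn_thickChart {k : ℝ × EM → EN} {O : Set (ℝ × EM)} (hk : ContDiffOn ℝ ∞ k O) :
    ContDiffOn ℝ ∞ (thickChart e k) {p : ℝ × (EM × F') | (p.1, p.2.1) ∈ O} := by
  refine contDiffOn_fst.prodMk (ContDiffOn.add ?_ ?_)
  · have hπ : ContDiff ℝ ∞ (fun p : ℝ × (EM × F') => ((p.1, p.2.1) : ℝ × EM)) :=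
      contDiff_fst.prodMk (contDiff_fst.comp contDiff_snd)
    exact hk.comp hπ.contDiffOn fun p hp => hp
  · exact ((e : (EM × F') →L[ℝ] EN).contDiff.comp
      ((contDiff_const (c := (0 : EM))).prodMk (contDiff_snd.comp contDiff_snd))).contDiffOn

omit [TopologicalSpace HM] [TopologicalSpace HN] in
/-- **The derivative of the thickening is a shear isomorphism** — the
`ContinuousLinearEquiv.skewProd` `(σ, (μ, w)) ↦ (σ, e (μ, w) + σ • D (1, 0))` — as soon as the
derivative `D` of `k̃` at the point satisfies `D (0, μ) = e (μ, 0)`. [folklore] -/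
theorem hasFDerivAt_thickChart {k : ℝ × EM → EN} {O : Set (ℝ × EM)} (hO : IsOpen O)
    (hk : ContDiffOn ℝ ∞ k O) {t₀ : ℝ} {u₀ : EM} (h₀ : (t₀, u₀) ∈ O)
    (hD : ∀ μ : EM, fderiv ℝ k (t₀, u₀) ((0 : ℝ), μ) = e (μ, (0 : F'))) :
    HasFDerivAt (thickChart e k)
      (((ContinuousLinearEquiv.refl ℝ ℝ).skewProd e ((1 : ℝ →L[ℝ] ℝ).smulRight
        (fderiv ℝ k (t₀, u₀) ((1 : ℝ), (0 : EM)))) :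
        (ℝ × (EM × F')) →L[ℝ] (ℝ × EN))) (t₀, (u₀, (0 : F'))) := by
  set D := fderiv ℝ k (t₀, u₀) with hDdef
  have hdiff : DifferentiableAt ℝ k (t₀, u₀) :=
    ((hk.differentiableOn (by simp)).differentiableAt (hO.mem_nhds h₀))
  set π : (ℝ × (EM × F')) →L[ℝ] (ℝ × EM) :=
    (ContinuousLinearMap.fst ℝ ℝ (EM × F')).prod
      ((ContinuousLinearMap.fst ℝ EM F').comp (ContinuousLinearMap.snd ℝ ℝ (EM × F'))) with hπ
  have hkπ : HasFDerivAt (fun p : ℝ × (EM × F') => k (p.1, p.2.1)) (D.comp π)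
      (t₀, (u₀, (0 : F'))) := by
    have h := hdiff.hasFDerivAt.comp (t₀, (u₀, (0 : F'))) π.hasFDerivAt
    exact h
  set ν : (ℝ × (EM × F')) →L[ℝ] EN :=
    (e : (EM × F') →L[ℝ] EN).comp ((ContinuousLinearMap.inr ℝ EM F').comp
      ((ContinuousLinearMap.snd ℝ EM F').comp (ContinuousLinearMap.snd ℝ ℝ (EM × F')))) with hν
  have hn : HasFDerivAt (fun p : ℝ × (EM × F') => e ((0 : EM), p.2.2)) ν (t₀, (u₀, (0 : F'))) :=
    ν.hasFDerivAt
  have hK : HasFDerivAt (thickChart e k)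
      ((ContinuousLinearMap.fst ℝ ℝ (EM × F')).prod (D.comp π + ν)) (t₀, (u₀, (0 : F'))) :=
    (ContinuousLinearMap.fst ℝ ℝ (EM × F')).hasFDerivAt.prodMk (hkπ.add hn)
  refine hK.congr_fderiv ?_
  apply ContinuousLinearMap.ext
  rintro ⟨σ, μ, w⟩
  have hdecomp : ((σ, μ) : ℝ × EM) = σ • ((1 : ℝ), (0 : EM)) + ((0 : ℝ), μ) := by
    ext <;> simp
  have hsplit : D (σ, μ) = σ • D ((1 : ℝ), (0 : EM)) + e (μ, (0 : F')) := by
    rw [hdecomp, map_add, map_smul, hDdef, hD μ]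
  have he : e (μ, w) = e (μ, (0 : F')) + e ((0 : EM), w) := by
    rw [← map_add, Prod.mk_add_mk, add_zero, zero_add]
  simp only [hπ, hν, ContinuousLinearMap.prod_apply, add_apply,
    ContinuousLinearMap.comp_apply, ContinuousLinearMap.coe_fst', ContinuousLinearMap.coe_snd',
    ContinuousLinearMap.inr_apply, ContinuousLinearEquiv.coe_coe,
    ContinuousLinearEquiv.skewProd_apply, ContinuousLinearEquiv.refl_apply,
    ContinuousLinearMap.smulRight_apply, hsplit, he]
  refine Prod.ext rfl ?_
  change σ • D ((1 : ℝ), (0 : EM)) + e (μ, (0 : F')) + e ((0 : EM), w) =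
    e (μ, (0 : F')) + e ((0 : EM), w) + ((1 : ℝ →L[ℝ] ℝ) σ) • D ((1 : ℝ), (0 : EM))
  rw [one_apply_eq_self]
  abel

/-! ### The left inverse from an extension of the chart expression -/

/-- **Chart-level left inverse of the track from an extension of its chart expression.**  Let
`φ` be a chart of `M` at `x₀`, `ψ` a chart of the maximal atlas of `N` at `F_{t₀} x₀` and
`e : EM × F' ≃L EN` a splitting in which the stage `F_{t₀}` reads `u ↦ e (u, 0)` on the target
of `φ` (Mathlib's immersion normal form), and let `k̃` be `C^∞` on an open `Õ ∋ (t₀, φ x₀)`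
and agree with the chart expression `trackChart F φ ψ (s, u) = ψ (F_s (φ⁻¹ u))` at the points
of `Õ` where the latter is meaningful (`u` in the target of `φ`, `F_s (φ⁻¹ u)` in the domain of
`ψ`).  Then there are an open `U ∋ (t₀, F_{t₀} x₀)` in `ℝ × N`, a map `Λ : ℝ × N → ℝ × EM`,
`C^∞` on `U` and mapping `U` into `Õ`, and an open `W ∋ (t₀, x₀)` in `ℝ × M` whose track lies
in `U`, such that `Λ (t, F_t x) = (t, φ x)` for all `(t, x) ∈ W`.  Proof: inverse function
theorem (`exists_openPartialHomeomorph_contDiffOn_symm`) for the thickening `thickChart e k̃`,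
whose derivative at `(t₀, φ x₀, 0)` is a shear isomorphism because the `u`-derivative of
`k̃ (t₀, ·)` is `e ∘ (·, 0)` (uniqueness of derivatives within the target of `φ`, a set of
unique differentiability); `Λ = pr ∘ K̃⁻¹ ∘ (id × ψ)`.  With `k̃ = trackChart` on the interior
this is `exists_localLeftInverse_track` followed by `φ`; over boundary points of a half-space
model `k̃` comes from Seeley's theorem (`exists_contDiffOn_extension_timeHalfSpace`).
Hirsch (1976), Ch. 8 §1, proof of Thm. 1.3 (the tubular neighbourhood of the track).
[cite: HirschDT1976, Ch. 8 §1, proof of Thm. 1.3] -/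
theorem exists_chartLeftInverse_of_extension [FiniteDimensional ℝ EN]
    (hψ : ψ ∈ IsManifold.maximalAtlas J ∞ N)
    {t₀ : ℝ} {x₀ : M} (hxφ : x₀ ∈ φ.source) (hyψ : F.toFun t₀ x₀ ∈ ψ.source)
    (hwr : EqOn (ψ.extend J ∘ F.toFun t₀ ∘ (φ.extend I).symm) (e ∘ fun u => (u, (0 : F')))
      (φ.extend I).target)
    {k : ℝ × EM → EN} {O : Set (ℝ × EM)} (hO : IsOpen O) (h₀ : (t₀, φ.extend I x₀) ∈ O)
    (hk : ContDiffOn ℝ ∞ k O)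
    (hagree : ∀ p ∈ O, p.2 ∈ (φ.extend I).target →
      F.toFun p.1 ((φ.extend I).symm p.2) ∈ ψ.source → k p = F.trackChart φ ψ p) :
    ∃ U : Set (ℝ × N), IsOpen U ∧ ((t₀, F.toFun t₀ x₀) : ℝ × N) ∈ U ∧
    ∃ Λ : ℝ × N → ℝ × EM, ContMDiffOn (𝓘(ℝ, ℝ).prod J) 𝓘(ℝ, ℝ × EM) ∞ Λ U ∧ MapsTo Λ U O ∧
    ∃ W : Set (ℝ × M), IsOpen W ∧ (t₀, x₀) ∈ W ∧
      MapsTo (fun q : ℝ × M => ((q.1, F.toFun q.1 q.2) : ℝ × N)) W U ∧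
      ∀ q ∈ W, Λ (q.1, F.toFun q.1 q.2) = (q.1, φ.extend I q.2) := by
  -- finite dimension (through `e`) and completeness of the chart spaces
  have hfinF' : FiniteDimensional ℝ F' :=
    Module.Finite.of_injective
      ((e : (EM × F') →L[ℝ] EN).toLinearMap.comp (LinearMap.inr ℝ EM F'))
      (e.injective.comp LinearMap.inr_injective)
  haveI : FiniteDimensional ℝ EM :=
    Module.Finite.of_injective
      ((e : (EM × F') →L[ℝ] EN).toLinearMap.comp (LinearMap.inl ℝ EM F'))
      (e.injective.comp LinearMap.inl_injective)
  haveI : CompleteSpace EM := FiniteDimensional.complete ℝ EM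
  haveI : CompleteSpace F' := FiniteDimensional.complete ℝ F'
  set u₀ : EM := φ.extend I x₀ with hu₀
  have hsymm₀ : (φ.extend I).symm u₀ = x₀ := φ.extend_left_inv hxφ
  have hu₀T : u₀ ∈ (φ.extend I).target := (φ.extend I).map_source (by rwa [φ.extend_source])
  -- the `u`-derivative of `k (t₀, ·)` at `u₀` is `e ∘ (·, 0)`
  set D := fderiv ℝ k (t₀, u₀) with hD
  have hdiff : DifferentiableAt ℝ k (t₀, u₀) :=
    ((hk.differentiableOn (by simp)).differentiableAt (hO.mem_nhds h₀))
  have hDμ : ∀ μ : EM, D ((0 : ℝ), μ) = e (μ, (0 : F')) := by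
    -- the set on which `k (t₀, ·) = e (·, 0)`
    set S : Set EM := (φ.extend I).target ∩ ({u | (t₀, u) ∈ O} ∩
      {u | F.toFun t₀ ((φ.extend I).symm u) ∈ ψ.source}) with hS
    have hu₀S : u₀ ∈ S := by
      refine ⟨hu₀T, h₀, ?_⟩
      show F.toFun t₀ ((φ.extend I).symm u₀) ∈ ψ.source
      rwa [hsymm₀]
    have hSeq : EqOn (fun u => k (t₀, u)) (e ∘ fun u => (u, (0 : F'))) S := by
      intro u hu
      show k (t₀, u) = (e ∘ fun u => (u, (0 : F'))) u
      rw [hagree (t₀, u) hu.2.1 hu.1 hu.2.2, trackChart_apply]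
      exact hwr hu.1
    have hSu : UniqueDiffWithinAt ℝ S u₀ := by
      have hT : UniqueDiffWithinAt ℝ (φ.extend I).target u₀ := by
        rw [φ.extend_target]
        exact I.uniqueDiffOn_preimage φ.open_target _ (by rwa [← φ.extend_target])
      refine hT.inter' (inter_mem ?_ ?_)
      · exact mem_nhdsWithin_of_mem_nhds ((hO.preimage (Continuous.prodMk_right t₀)).mem_nhds h₀)
      · have h1 : Continuous fun y : M => F.toFun t₀ y :=
          F.contMDiff.continuous.comp (Continuous.prodMk_right t₀)
        have hc : ContinuousWithinAt (fun u => F.toFun t₀ ((φ.extend I).symm u))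
            (φ.extend I).target u₀ :=
          h1.continuousAt.comp_continuousWithinAt (φ.continuousOn_extend_symm u₀ hu₀T)
        refine hc.preimage_mem_nhdsWithin (ψ.open_source.mem_nhds ?_)
        simpa only [hsymm₀] using hyψ
    have hA : HasFDerivWithinAt (fun u => k (t₀, u)) (D.comp (ContinuousLinearMap.inr ℝ ℝ EM))
        S u₀ :=
      (hdiff.hasFDerivAt.comp u₀ (hasFDerivAt_prodMk_right (𝕜 := ℝ) t₀ u₀)).hasFDerivWithinAt
    have hB : HasFDerivWithinAt (fun u => k (t₀, u))
        ((e : (EM × F') →L[ℝ] EN).comp (ContinuousLinearMap.inl ℝ EM F')) S u₀ :=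
      (((e : (EM × F') →L[ℝ] EN).hasFDerivAt).comp u₀
        (ContinuousLinearMap.inl ℝ EM F').hasFDerivAt).hasFDerivWithinAt.congr' hSeq hu₀S
    have hAB := hSu.eq hA hB
    intro μ
    have := congrArg (fun T : EM →L[ℝ] EN => T μ) hAB
    simpa using this
  -- the inverse function theorem for the thickening
  have hO' : IsOpen {p : ℝ × (EM × F') | (p.1, p.2.1) ∈ O} :=
    hO.preimage (continuous_fst.prodMk (continuous_fst.comp continuous_snd))
  have ha : ((t₀, (u₀, (0 : F'))) : ℝ × (EM × F')) ∈ {p : ℝ × (EM × F') | (p.1, p.2.1) ∈ O} := h₀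
  obtain ⟨G, hGK, haG, hGsrc, -, hGsymm⟩ :=
    exists_openPartialHomeomorph_contDiffOn_symm hO' ha (m := ∞) (by simp)
      (contDiffOn_thickChart e hk) _ (hasFDerivAt_thickChart e hO hk h₀ hDμ)
  -- value of the thickening on the slice `w = 0` at chart points
  have hKslice : ∀ s : ℝ, ∀ x ∈ φ.source, (s, (φ.extend I x, (0 : F'))) ∈ G.source →
      F.toFun s x ∈ ψ.source →
      thickChart e k (s, (φ.extend I x, 0)) = (s, ψ.extend J (F.toFun s x)) := by
    intro s x hx hG hψs
    have hxT : φ.extend I x ∈ (φ.extend I).target :=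
      (φ.extend I).map_source (by rwa [φ.extend_source])
    rw [thickChart_apply, hagree (s, φ.extend I x) (hGsrc hG) hxT
      (by simpa only [φ.extend_left_inv hx] using hψs), trackChart_apply, φ.extend_left_inv hx]
    simp
  -- `U` and `Λ`
  set U : Set (ℝ × N) := {p | p.2 ∈ ψ.source ∧ (p.1, ψ.extend J p.2) ∈ G.target} with hU
  set Λ : ℝ × N → ℝ × EM := fun p =>
    ((G.symm (p.1, ψ.extend J p.2)).1, (G.symm (p.1, ψ.extend J p.2)).2.1) with hΛ
  have hUo : IsOpen U := by
    have hc : ContinuousOn (fun p : ℝ × N => (p.1, ψ.extend J p.2)) ((univ : Set ℝ) ×ˢ ψ.source) :=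
      continuousOn_fst.prodMk ((ψ.continuousOn_extend.mono (by rw [ψ.extend_source])).comp
        continuousOn_snd fun p hp => hp.2)
    have h := hc.isOpen_inter_preimage (isOpen_univ.prod ψ.open_source) G.open_target
    convert h using 1
    ext p
    simp only [hU, mem_setOf_eq, mem_inter_iff, mem_prod, mem_univ, true_and, mem_preimage]
  refine ⟨U, hUo, ?_, Λ, ?_, ?_, ?_⟩
  · refine ⟨hyψ, ?_⟩
    have h := G.map_source haG
    rwa [hGK, hKslice t₀ x₀ hxφ haG hyψ] at h
  · have h1 : ContMDiffOn (𝓘(ℝ, ℝ).prod J) 𝓘(ℝ, ℝ × EN) ∞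
        (fun p : ℝ × N => ((p.1, ψ.extend J p.2) : ℝ × EN)) U := by
      refine contMDiffOn_fst.prodMk_space ?_
      exact (ψ.contMDiffOn_extend hψ).comp contMDiffOn_snd fun p hp => hp.1
    have h2 : ContMDiffOn (𝓘(ℝ, ℝ).prod J) 𝓘(ℝ, ℝ × (EM × F')) ∞
        (fun p : ℝ × N => G.symm (p.1, ψ.extend J p.2)) U :=
      hGsymm.contMDiffOn.comp h1 fun p hp => hp.2
    have h3 : ContMDiff 𝓘(ℝ, ℝ × (EM × F')) 𝓘(ℝ, ℝ × EM) ∞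
        fun r : ℝ × (EM × F') => ((r.1, r.2.1) : ℝ × EM) :=
      (contDiff_fst.prodMk (contDiff_fst.comp contDiff_snd)).contMDiff
    exact (h3.comp_contMDiffOn h2).congr fun p _ => rfl
  · intro p hp
    exact hGsrc (G.map_target hp.2)
  · set W : Set (ℝ × M) := {q | q.2 ∈ φ.source ∧ F.toFun q.1 q.2 ∈ ψ.source ∧
      (q.1, (φ.extend I q.2, (0 : F'))) ∈ G.source} with hW
    have hWo : IsOpen W := by
      have hc : ContinuousOn
          (fun q : ℝ × M => ((q.1, (φ.extend I q.2, (0 : F'))) : ℝ × (EM × F')))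
          ((univ : Set ℝ) ×ˢ φ.source) :=
        continuousOn_fst.prodMk (((φ.continuousOn_extend.mono (by rw [φ.extend_source])).comp
          continuousOn_snd fun q hq => hq.2).prodMk continuousOn_const)
      have h := hc.isOpen_inter_preimage (isOpen_univ.prod φ.open_source) G.open_source
      have h' : IsOpen ((uncurry F.toFun) ⁻¹' ψ.source) :=
        ψ.open_source.preimage F.contMDiff.continuous
      convert (h.inter h') using 1
      ext q
      simp only [hW, mem_setOf_eq, mem_inter_iff, mem_prod, mem_univ, true_and, mem_preimage,
        uncurry]
      tauto
    refine ⟨W, hWo, ⟨hxφ, hyψ, haG⟩, fun q hq => ?_, fun q hq => ?_⟩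
    · obtain ⟨s, x⟩ := q
      obtain ⟨hx, hψs, hG⟩ := hq
      refine ⟨hψs, ?_⟩
      have h := G.map_source hG
      rwa [hGK, hKslice s x hx hG hψs] at h
    · obtain ⟨s, x⟩ := q
      obtain ⟨hx, hψs, hG⟩ := hq
      have hinv : G.symm (s, ψ.extend J (F.toFun s x)) = (s, (φ.extend I x, 0)) := by
        rw [← hKslice s x hx hG hψs, ← hGK]
        exact G.left_inv hG
      simp only [hΛ, hinv]

end SmoothIsotopy

end Literature.Topology.FourManifolds
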